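import Summits.HubbardSuperconductivity.HubbardSuperconductivity.Theorems.AnisotropyChordTransferFibre3B1BracketRing
import Summits.HubbardSuperconductivity.HubbardSuperconductivity.Theorems.AnisotropyChordTransferFibre3B1EvalSound

/-!
# Route `AnisotropyChord` / H0 rotor rung, LEVEL 2 family B1: the RING bracket — lower half, ν-cell form and the KERNEL EVALUATOR `cellCheckR`

Sibling of `…Fibre3B1BracketRing` (`b1_upperR`: `θ^{2n}·torSum ≤ fullSum ν θ₀ R s a + tailConst ν (R − S) n`).  Here:
★ `b1_lowerR` (the `q²`-lower window sum over the LARGE window `R`, `2(R + S) < L`), ★★ `b1BracketR`, the `ν`-cell form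
★★ `b1BracketR_cell` (endpoint evaluations: `loSum` at `ν₁`, `fullSum` and `tailConst` at `ν₂`, by monotonicity), and the exact
integer/rational evaluator: `djQ` (the ring weight with `T ≥ θ₀²`, `piHi ≥ π`), `fullTermZ`/`fullSumZ` (rounded UP), ★ `cellCheckR`
(same shape as `B1.cellCheck` with the ring radius `R`: `S + 2 ≤ R`, `2(R + S) < L₀`, `L₀/2 + R < L₀`) and ★★ `cell_soundR`:
`cellCheckR … = true ⟹ clo ≤ θ^{2n}·torSum L (νθ²) s a ≤ chi` for every `L ≥ L₀`, `ν ∈ [n₁/νd, n₂/νd]` — the drop-in for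
`B1.cell_sound` in block cells (`L2.TCell`-type certificates with `R = L₀/2 − S − 1`).  Exact-ℚ mirror (p1 g32): `θ⁴S₂` width
`.106 → .063` at `L₀ = 64`, `.031 → .020` at `128`.
Prover seat `hubbard-h0-rotor-p1` g32 (route lead; ASK 3 of the t-block campaign); helper for piece A =
stmt-HubbardSuperconductivity-23918 of rung 19089 (`--supports`, helper class).  Nothing here proves superconductivity in the
Hubbard model; helper lemmas + a kernel evaluator of ONE conditional reduction (the GM₃ ∀L certificate, Level-2 brackets).
Mathlib + the tree only; no sorry.
-/

set_option linter.dupNamespace false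
set_option autoImplicit false

open scoped BigOperators

namespace Summit.HubbardSuperconductivity.HubbardSuperconductivity.Theorems.AnisotropyChord.Transfer.Fibre3.B1

/-! ## The evaluator (computable) -/

/-- the ring weight in rationals: `max(W_T(q), 4|q|²/piHi²)` (`T ≥ θ₀²`, `piHi ≥ π` make it a LOWER bound of `djE θ₀ q`). -/
def djQ (T : ℚ) (q : ℤ × ℤ) : ℚ :=
  max (((q.1 : ℤ) : ℚ) ^ 2 * (1 - T * ((q.1 : ℤ) : ℚ) ^ 2 / 12) + ((q.2 : ℤ) : ℚ) ^ 2 * (1 - T * ((q.2 : ℤ) : ℚ) ^ 2 / 12))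
    (4 / piHi ^ 2 * (((q.1 : ℤ) : ℚ) ^ 2 + ((q.2 : ℤ) : ℚ) ^ 2))

/-- all shifted points are off the origin (Boolean). -/
def allNZ {m : ℕ} (s : Fin m → ℤ × ℤ) (p : ℤ × ℤ) : Bool :=
  (List.finRange m).all fun t => decide (p + s t ≠ (0, 0))

/-- one term of `D·fullSum`, rounded UP: `⌈D · Π_t (djQ T (p + s_t) − ν)^{−a_t}⌉` if every `p + s_t ≠ 0`, else `0`. -/
def fullTermZ (νn νd Tn Td : ℤ) {m : ℕ} (s : Fin m → ℤ × ℤ) (a : Fin m → ℕ) (D : ℕ) (p : ℤ × ℤ) : ℤ :=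
  if allNZ s p then
    ⌈(D : ℚ) * ((List.finRange m).map fun t => (1 / (djQ ((Tn : ℚ) / Td) (p + s t) - (νn : ℚ) / νd)) ^ a t).prod⌉
  else 0

/-- `D · fullSum (νn/νd) θ₀ R s a ≤ fullSumZ` whenever `θ₀² ≤ Tn/Td`, `νn/νd < 4/piHi²` (`fullSum_le_fullSumZ`). -/
def fullSumZ (νn νd Tn Td : ℤ) (R : ℕ) {m : ℕ} (s : Fin m → ℤ × ℤ) (a : Fin m → ℕ) (D : ℕ) : ℤ :=
  gridSum R (fullTermZ νn νd Tn Td s a D)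

/-- ★ THE RING CELL CERTIFICATE of a named B1 sum on the `ν`-cell `[n₁/νd, n₂/νd]` at `θ₀ = 2π/L₀` with ring radius `R`:
side conditions (`0 < νd`, `0 < Td`, `0 ≤ n₁ ≤ n₂`, `n₂/νd < 4/piHi²`, `(2·piHi/L₀)² ≤ Tn/Td`, `S + 2 ≤ R`, `2(R + S) < L₀`,
`L₀/2 + R < L₀`, exponents `≥ 1` summing to `n ≥ 2`, `|s_t|∞ ≤ S`) and the two evaluations
`clo·D ≤ loSumZ(n₁; window R)` and `fullSumZ(n₂) ≤ (chi − tailConstQ(n₂, R − S))·D`. -/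
def cellCheckR (L0 : ℕ) (n1 n2 νd Tn Td : ℤ) (S : ℕ) {m : ℕ} (s : Fin m → ℤ × ℤ) (a : Fin m → ℕ) (n D : ℕ)
    (clo chi : ℚ) (R : ℕ) : Bool :=
  decide (0 < νd) && decide (0 < Td) && decide (0 ≤ n1) && decide (n1 ≤ n2) &&
  decide ((n2 : ℚ) / νd * piHi ^ 2 < 4) &&
  decide ((2 * piHi / L0) ^ 2 * Td ≤ Tn) &&
  decide (S + 2 ≤ R) && decide (2 * (R + S) < L0) && decide (L0 / 2 + R < L0) && decide (0 < D) && decide (2 ≤ n) &&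
  decide (((List.finRange m).map a).sum = n) &&
  ((List.finRange m).all fun t => decide (1 ≤ a t) && decide ((s t).1.natAbs ≤ S) && decide ((s t).2.natAbs ≤ S)) &&
  decide (clo * D ≤ (loSumZ n1 νd R S s a n D : ℚ)) &&
  decide (((fullSumZ n2 νd Tn Td R s a D : ℤ) : ℚ) ≤ (chi - tailConstQ n2 νd (R - S) n) * D)

/-! ## The lower half and the two-sided bracket -/

noncomputable section

variable (L : ℕ) [NeZero L]

variable {ι : Type*} [Fintype ι]

/-- LOWER per factor on the torus with only `2K < L` (angles `|θq_c| ≤ π` from `|q_c| ≤ K ≤ L/2`). [folklore] -/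
theorem Xf_lowerR (ν : ℝ) (hν : ν < 4 / Real.pi ^ 2) (K : ℕ) (h2K : 2 * K < L) (t : ℤ × ℤ) (k : Tor L)
    (q : ℤ × ℤ) (hq : q ∈ zWindow K) (h : k + toTor L t = toTor L q) :
    1 / (nsq q - ν) ≤ Xf L ν t k := by
  have hLpos : (0 : ℝ) < L := by exact_mod_cast Nat.pos_of_ne_zero (NeZero.ne L)
  have hθpos : 0 < 2 * Real.pi / L := by positivity
  have hpi := Real.pi_pos
  have hq' := hq
  rw [mem_zWindow_iff] at hq'
  obtain ⟨hq0, ⟨h1a, h1b⟩, ⟨h2a, h2b⟩⟩ := hq'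
  have hne : toTor L q ≠ 0 := intCast_ne_zero_of_mem_zWindow L K (by omega) q hq
  rw [Xf_eq_of_lift L ν t k q h hne]
  unfold nsq
  have hKL : 2 * (K : ℝ) ≤ L := by exact_mod_cast h2K.le
  have hang : ∀ z : ℤ, -(K : ℤ) ≤ z → z ≤ K → |2 * Real.pi / L * ((z : ℤ) : ℝ)| ≤ Real.pi := by
    intro z hz1 hz2
    have hz : |((z : ℤ) : ℝ)| ≤ K := by
      rw [abs_le]; constructor <;> exact_mod_cast (by omega : _) 
    rw [abs_mul, abs_of_pos hθpos, div_mul_eq_mul_div, div_le_iff₀ hLpos]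
    nlinarith [abs_nonneg (((z : ℤ) : ℝ))]
  exact factor_lower _ ν _ _ hθpos hν (one_le_sq_add_sq _ _ hq0) (hang q.1 h1a h1b) (hang q.2 h2a h2b)

/-- ★ **LOWER half with window `R`** (`2(R + S) < L`): `loSum ν R S s a ≤ θ^{2n}·torSum`. -/
theorem b1_lowerR (R S : ℕ) (s : ι → ℤ × ℤ) (a : ι → ℕ) (n : ℕ) (hn : ∑ i, a i = n)
    (h2RS : 2 * (R + S) < L) (ν : ℝ) (hν : ν < 4 / Real.pi ^ 2) :
    loSum ν R S s a ≤ (2 * Real.pi / L) ^ (2 * n) * torSum L (ν * (2 * Real.pi / L) ^ 2) s a := by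
  classical
  rw [scaled_torSum_eq L ν s a n hn]
  have hinj : Set.InjOn (toTor L) (idx R S s : Set (ℤ × ℤ)) := by
    intro p hp q hq hpq
    rw [Finset.mem_coe, mem_idx_iff, mem_box_iff] at hp hq
    exact intCast_eq_of_mem_box L (R + S) h2RS p q hp.1 hq.1 hpq
  have hterm : ∀ p ∈ idx R S s,
      ∏ i, (1 / (nsq (p + s i) - ν)) ^ a i ≤ ∏ i, Xf L ν (s i) (toTor L p) ^ a i := by
    intro p hp
    rw [mem_idx_iff] at hp
    apply Finset.prod_le_prod
    · intro i _
      exact pow_nonneg (lo_nonneg ν hν _ ((mem_zWindow_iff R _).1 (hp.2 i)).1) _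
    · intro i _
      exact pow_le_pow_left₀ (lo_nonneg ν hν _ ((mem_zWindow_iff R _).1 (hp.2 i)).1)
        (Xf_lowerR L ν hν R (by omega) (s i) (toTor L p) (p + s i) (hp.2 i) (by rw [toTor_add])) _
  have hT0 : ∀ k : Tor L, 0 ≤ ∏ i, Xf L ν (s i) k ^ a i :=
    fun k => Finset.prod_nonneg fun i _ => pow_nonneg (Xf_nonneg L ν hν _ _) _
  unfold loSum
  calc ∑ p ∈ idx R S s, ∏ i, (1 / (nsq (p + s i) - ν)) ^ a i
      ≤ ∑ p ∈ idx R S s, ∏ i, Xf L ν (s i) (toTor L p) ^ a i := Finset.sum_le_sum hterm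
    _ = ∑ k ∈ (idx R S s).image (toTor L), ∏ i, Xf L ν (s i) k ^ a i := by rw [Finset.sum_image hinj]
    _ ≤ ∑ k : Tor L, ∏ i, Xf L ν (s i) k ^ a i :=
        Finset.sum_le_sum_of_subset_of_nonneg (Finset.subset_univ _) (fun k _ _ => hT0 k)

/-- ★★ **THE RING-SHARPENED L-UNIFORM B1 BRACKET**: for `θ = 2π/L ≤ θ₀`, shifts `|s_i|∞ ≤ S`, exponents `a_i ≥ 1`,
`Σ a_i = n ≥ 2`, `S + 2 ≤ R`, `2(R + S) < L`, `L/2 + R < L`, `0 ≤ ν < 4/π²`: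
`loSum ν R S s a ≤ θ^{2n}·torSum L (νθ²) ≤ fullSum ν θ₀ R s a + tailConst ν (R − S) n`. -/
theorem b1BracketR (θ0 : ℝ) (R S : ℕ) (s : ι → ℤ × ℤ) (a : ι → ℕ) (n : ℕ)
    (ha : ∀ i, 1 ≤ a i) (hn : ∑ i, a i = n) (h2 : 2 ≤ n)
    (hS : ∀ i, (s i).1.natAbs ≤ S ∧ (s i).2.natAbs ≤ S) (hSR : S + 2 ≤ R)
    (h2RS : 2 * (R + S) < L) (hRL : L / 2 + R < L) (hθ0 : 2 * Real.pi / L ≤ θ0)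
    (ν : ℝ) (hν0 : 0 ≤ ν) (hν : ν < 4 / Real.pi ^ 2) :
    loSum ν R S s a ≤ (2 * Real.pi / L) ^ (2 * n) * torSum L (ν * (2 * Real.pi / L) ^ 2) s a ∧
      (2 * Real.pi / L) ^ (2 * n) * torSum L (ν * (2 * Real.pi / L) ^ 2) s a
        ≤ fullSum ν θ0 R s a + tailConst ν (R - S) n :=
  ⟨b1_lowerR L R S s a n hn h2RS ν hν, b1_upperR L θ0 R S s a n ha hn h2 hS hSR h2RS hRL hθ0 ν hν0 hν⟩


/-- `fullSum` is increasing in `ν`. [folklore] -/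
theorem fullSum_mono (ν ν' : ℝ) (hνν' : ν ≤ ν') (hν' : ν' < 4 / Real.pi ^ 2) (θ0 : ℝ) (R : ℕ) (s : ι → ℤ × ℤ)
    (a : ι → ℕ) : fullSum ν θ0 R s a ≤ fullSum ν' θ0 R s a := by
  unfold fullSum
  have hν : ν < 4 / Real.pi ^ 2 := lt_of_le_of_lt hνν' hν'
  apply Finset.sum_le_sum
  intro p _
  apply Finset.prod_le_prod
  · intro i _
    exact ringTerm_nonneg ν θ0 hν _ _
  · intro i _
    unfold ringTerm
    split_ifs with hz
    · exact le_rfl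
    · apply pow_le_pow_left₀ (div_nonneg zero_le_one (djE_sub_pos θ0 ν hν _ hz).le)
      exact one_div_le_one_div_of_le (djE_sub_pos θ0 ν' hν' _ hz) (by linarith)

/-- ★★ **THE RING BRACKET ON A ν-CELL**: for `0 ≤ ν₁ ≤ ν ≤ ν₂ < 4/π²` (and the hypotheses of `b1BracketR`),
`loSum ν₁ R S s a ≤ θ^{2n}·torSum L (νθ²) ≤ fullSum ν₂ θ₀ R s a + tailConst ν₂ (R − S) n`. -/
theorem b1BracketR_cell (θ0 : ℝ) (R S : ℕ) (s : ι → ℤ × ℤ) (a : ι → ℕ) (n : ℕ)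
    (ha : ∀ i, 1 ≤ a i) (hn : ∑ i, a i = n) (h2 : 2 ≤ n)
    (hS : ∀ i, (s i).1.natAbs ≤ S ∧ (s i).2.natAbs ≤ S) (hSR : S + 2 ≤ R)
    (h2RS : 2 * (R + S) < L) (hRL : L / 2 + R < L) (hθ0 : 2 * Real.pi / L ≤ θ0)
    (ν₁ ν ν₂ : ℝ) (hν₁ : 0 ≤ ν₁) (h1 : ν₁ ≤ ν) (h2' : ν ≤ ν₂) (hν₂ : ν₂ < 4 / Real.pi ^ 2) :
    loSum ν₁ R S s a ≤ (2 * Real.pi / L) ^ (2 * n) * torSum L (ν * (2 * Real.pi / L) ^ 2) s a ∧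
      (2 * Real.pi / L) ^ (2 * n) * torSum L (ν * (2 * Real.pi / L) ^ 2) s a
        ≤ fullSum ν₂ θ0 R s a + tailConst ν₂ (R - S) n := by
  have hν : ν < 4 / Real.pi ^ 2 := lt_of_le_of_lt h2' hν₂
  have hν0 : 0 ≤ ν := hν₁.trans h1
  obtain ⟨hlo, hhi⟩ := b1BracketR L θ0 R S s a n ha hn h2 hS hSR h2RS hRL hθ0 ν hν0 hν
  refine ⟨(loSum_mono ν₁ ν h1 hν R S s a).trans hlo, hhi.trans ?_⟩
  exact add_le_add (fullSum_mono ν ν₂ h2' hν₂ θ0 R s a)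
    (tailConst_mono ν ν₂ hν0 h2' hν₂ (R - S) n (by omega))

/-! ## Soundness of the evaluator -/

/-- the rational ring weight is a lower bound of the real one: `djQ T q ≤ djE θ₀ q` for `θ₀²·Td ≤ Tn` (`T = Tn/Td`). [folklore] -/
theorem djQ_le_djE (Tn Td : ℤ) (hTd : 0 < Td) (θ0 : ℝ) (hT : θ0 ^ 2 * Td ≤ Tn) (q : ℤ × ℤ) :
    ((djQ ((Tn : ℚ) / Td) q : ℚ) : ℝ) ≤ djE θ0 q := by
  have hpi := Real.pi_pos
  have hP : Real.pi ≤ ((piHi : ℚ) : ℝ) := by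
    have e : ((piHi : ℚ) : ℝ) = 3.1416 := by unfold piHi; norm_num
    rw [e]; exact Real.pi_lt_d4.le
  have hTdR : (0 : ℝ) < Td := by exact_mod_cast hTd
  have hTR : θ0 ^ 2 ≤ (Tn : ℝ) / Td := by rw [le_div_iff₀ hTdR]; exact_mod_cast hT
  unfold djQ djE winE nsq
  push_cast
  apply max_le_max
  · have h1 : 0 ≤ ((q.1 : ℤ) : ℝ) ^ 2 * ((q.1 : ℤ) : ℝ) ^ 2 := by positivity
    have h2 : 0 ≤ ((q.2 : ℤ) : ℝ) ^ 2 * ((q.2 : ℤ) : ℝ) ^ 2 := by positivity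
    nlinarith [mul_le_mul_of_nonneg_left hTR h1, mul_le_mul_of_nonneg_left hTR h2]
  · have hq : 0 ≤ ((q.1 : ℤ) : ℝ) ^ 2 + ((q.2 : ℤ) : ℝ) ^ 2 := by positivity
    have hπ2 : Real.pi ^ 2 ≤ ((piHi : ℚ) : ℝ) ^ 2 := pow_le_pow_left₀ hpi.le hP 2
    have h4 : 4 / (((piHi : ℚ) : ℝ)) ^ 2 ≤ 4 / Real.pi ^ 2 := div_le_div_of_nonneg_left (by norm_num) (by positivity) hπ2
    exact mul_le_mul_of_nonneg_right h4 hq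

/-- positivity of the rational ring denominator off the origin for `νn/νd < 4/piHi²`. [folklore] -/
theorem djQ_sub_pos (νn νd Tn Td : ℤ) (hc : (νn : ℚ) / νd * piHi ^ 2 < 4) (q : ℤ × ℤ)
    (hq : q ≠ (0, 0)) : 0 < djQ ((Tn : ℚ) / Td) q - (νn : ℚ) / νd := by
  have h1 : (1 : ℚ) ≤ ((q.1 : ℤ) : ℚ) ^ 2 + ((q.2 : ℤ) : ℚ) ^ 2 := by
    have h := one_le_sq_add_sq_int q hq
    exact_mod_cast h
  have hP : (0 : ℚ) < piHi ^ 2 := by unfold piHi; norm_num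
  have h4 : (0 : ℚ) < 4 / piHi ^ 2 := by positivity
  have hJ : 4 / piHi ^ 2 * 1 ≤ 4 / piHi ^ 2 * (((q.1 : ℤ) : ℚ) ^ 2 + ((q.2 : ℤ) : ℚ) ^ 2) :=
    mul_le_mul_of_nonneg_left h1 h4.le
  have hm : 4 / piHi ^ 2 * (((q.1 : ℤ) : ℚ) ^ 2 + ((q.2 : ℤ) : ℚ) ^ 2) ≤ djQ ((Tn : ℚ) / Td) q := le_max_right _ _
  have hν : (νn : ℚ) / νd < 4 / piHi ^ 2 := by rw [lt_div_iff₀ hP]; exact hc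
  linarith

/-- termwise UPPER evaluation of the full box sum: `D·Π_t ringTerm(p + s_t, a_t) ≤ fullTermZ p`. [folklore] -/
theorem fullTerm_le_fullTermZ (νn νd Tn Td : ℤ) (hTd : 0 < Td) (hc : (νn : ℚ) / νd * piHi ^ 2 < 4)
    (θ0 : ℝ) (hT : θ0 ^ 2 * Td ≤ Tn) (hν4 : (νn : ℝ) / νd < 4 / Real.pi ^ 2)
    {m : ℕ} (s : Fin m → ℤ × ℤ) (a : Fin m → ℕ) (D : ℕ) (p : ℤ × ℤ) :
    (D : ℝ) * ∏ t, ringTerm ((νn : ℝ) / νd) θ0 (p + s t) (a t) ≤ ((fullTermZ νn νd Tn Td s a D p : ℤ) : ℝ) := by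
  unfold fullTermZ allNZ
  by_cases hz : ∀ t, p + s t ≠ (0, 0)
  · have hall : ((List.finRange m).all fun t => decide (p + s t ≠ (0, 0))) = true := by
      rw [List.all_eq_true]; intro t _; exact decide_eq_true (hz t)
    rw [hall, if_pos rfl]
    set xq : ℚ := (D : ℚ) * ((List.finRange m).map fun t =>
      (1 / (djQ ((Tn : ℚ) / Td) (p + s t) - (νn : ℚ) / νd)) ^ a t).prod with hxq
    have hxq' : xq = (D : ℚ) * ∏ t, (1 / (djQ ((Tn : ℚ) / Td) (p + s t) - (νn : ℚ) / νd)) ^ a t := by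
      rw [hxq, list_prod_finRange]
    have hle : (D : ℝ) * ∏ t, ringTerm ((νn : ℝ) / νd) θ0 (p + s t) (a t) ≤ ((xq : ℚ) : ℝ) := by
      rw [hxq']
      push_cast
      apply mul_le_mul_of_nonneg_left _ (by positivity)
      apply Finset.prod_le_prod
      · intro t _
        exact ringTerm_nonneg _ θ0 hν4 _ _
      · intro t _
        rw [ringTerm_of_ne _ θ0 _ (hz t)]
        have hpos : (0 : ℝ) < ((djQ ((Tn : ℚ) / Td) (p + s t) : ℚ) : ℝ) - (νn : ℝ) / νd := by
          have h := djQ_sub_pos νn νd Tn Td hc (p + s t) (hz t)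
          have h' : (0 : ℝ) < (((djQ ((Tn : ℚ) / Td) (p + s t) - (νn : ℚ) / νd : ℚ)) : ℝ) := by exact_mod_cast h
          push_cast at h'; exact h'
        apply pow_le_pow_left₀ (div_nonneg zero_le_one (djE_sub_pos θ0 _ hν4 _ (hz t)).le)
        exact one_div_le_one_div_of_le hpos (by linarith [djQ_le_djE Tn Td hTd θ0 hT (p + s t)])
    have hceil : ((xq : ℚ) : ℝ) ≤ ((⌈xq⌉ : ℤ) : ℝ) := by
      have h := Int.le_ceil xq
      exact_mod_cast h
    exact hle.trans hceil
  · have hall : ((List.finRange m).all fun t => decide (p + s t ≠ (0, 0))) = false := by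
      rw [Bool.eq_false_iff]; intro h; apply hz; rw [List.all_eq_true] at h
      intro t; exact of_decide_eq_true (h t (List.mem_finRange t))
    rw [hall]
    push Not at hz
    obtain ⟨t, ht⟩ := hz
    have h0 : ∏ t, ringTerm ((νn : ℝ) / νd) θ0 (p + s t) (a t) = 0 := by
      apply Finset.prod_eq_zero (Finset.mem_univ t)
      unfold ringTerm; rw [if_pos ht]
    rw [h0, mul_zero]
    simp

/-- ★ UPPER evaluation: `D · fullSum (νn/νd) θ₀ R s a ≤ fullSumZ`. -/
theorem fullSum_le_fullSumZ (νn νd Tn Td : ℤ) (hTd : 0 < Td) (hc : (νn : ℚ) / νd * piHi ^ 2 < 4)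
    (θ0 : ℝ) (hT : θ0 ^ 2 * Td ≤ Tn) (hν4 : (νn : ℝ) / νd < 4 / Real.pi ^ 2)
    (R : ℕ) {m : ℕ} (s : Fin m → ℤ × ℤ) (a : Fin m → ℕ) (D : ℕ) :
    (D : ℝ) * fullSum ((νn : ℝ) / νd) θ0 R s a ≤ ((fullSumZ νn νd Tn Td R s a D : ℤ) : ℝ) := by
  unfold fullSumZ fullSum
  rw [cast_gridSum, sum_box_eq_grid, Finset.mul_sum]
  refine Finset.sum_le_sum fun i _ => ?_
  rw [Finset.mul_sum]
  refine Finset.sum_le_sum fun j _ => ?_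
  exact fullTerm_le_fullTermZ νn νd Tn Td hTd hc θ0 hT hν4 s a D _

/-- ★★ **SOUNDNESS OF THE RING CELL CERTIFICATE**: if `cellCheckR L₀ n₁ n₂ νd Tn Td S s a n D clo chi R = true` then for
every `L ≥ L₀` and every `ν ∈ [n₁/νd, n₂/νd]`:  `clo ≤ (2π/L)^{2n} · torSum L (ν·(2π/L)²) s a ≤ chi`. -/
theorem cell_soundR (L0 : ℕ) (n1 n2 νd Tn Td : ℤ) (S : ℕ) {m : ℕ} (s : Fin m → ℤ × ℤ) (a : Fin m → ℕ) (n D : ℕ)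
    (clo chi : ℚ) (R : ℕ) (h : cellCheckR L0 n1 n2 νd Tn Td S s a n D clo chi R = true)
    (L : ℕ) [NeZero L] (hL : L0 ≤ L) (ν : ℝ) (hν1 : (n1 : ℝ) / νd ≤ ν) (hν2 : ν ≤ (n2 : ℝ) / νd) :
    ((clo : ℚ) : ℝ) ≤ (2 * Real.pi / L) ^ (2 * n) * torSum L (ν * (2 * Real.pi / L) ^ 2) s a ∧
      (2 * Real.pi / L) ^ (2 * n) * torSum L (ν * (2 * Real.pi / L) ^ 2) s a ≤ ((chi : ℚ) : ℝ) := by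
  unfold cellCheckR at h
  simp only [Bool.and_eq_true, decide_eq_true_eq, List.all_eq_true] at h
  obtain ⟨⟨⟨⟨⟨⟨⟨⟨⟨⟨⟨⟨⟨⟨hνd, hTd⟩, hn1⟩, hn12⟩, hc⟩, hT⟩, hSR⟩, h2RS⟩, hRL⟩, hD⟩, h2⟩, hsum⟩, hsa⟩, hlo⟩, hhi⟩ := h
  have hpi := Real.pi_pos
  have hP : Real.pi ≤ ((piHi : ℚ) : ℝ) := by
    have e : ((piHi : ℚ) : ℝ) = 3.1416 := by unfold piHi; norm_num
    rw [e]; exact Real.pi_lt_d4.le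
  have ha : ∀ t, 1 ≤ a t := fun t => (hsa t (List.mem_finRange t)).1.1
  have hS : ∀ t, (s t).1.natAbs ≤ S ∧ (s t).2.natAbs ≤ S := fun t =>
    ⟨(hsa t (List.mem_finRange t)).1.2, (hsa t (List.mem_finRange t)).2⟩
  have hn : ∑ t, a t = n := by rw [← hsum, list_sum_finRange]
  have hνdR : (0 : ℝ) < νd := by exact_mod_cast hνd
  have hν1_0 : (0 : ℝ) ≤ (n1 : ℝ) / νd := div_nonneg (by exact_mod_cast hn1) hνdR.le
  have hcR : (n2 : ℝ) / νd * (((piHi : ℚ) : ℝ)) ^ 2 < 4 := by exact_mod_cast hc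
  have hν2_lt : (n2 : ℝ) / νd < 4 / Real.pi ^ 2 := by
    rw [lt_div_iff₀ (by positivity)]
    have : Real.pi ^ 2 ≤ (((piHi : ℚ) : ℝ)) ^ 2 := pow_le_pow_left₀ hpi.le hP 2
    have hn2R : (0 : ℝ) ≤ (n2 : ℝ) / νd := div_nonneg (by exact_mod_cast (hn1.trans hn12)) hνdR.le
    nlinarith
  -- scales: θ ≤ θ₀ = 2π/L₀, and the ring conditions at L from those at L₀
  have hL0pos : 0 < L0 := by omega
  have hL0R : (0 : ℝ) < L0 := by exact_mod_cast hL0pos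
  have hLR : (L0 : ℝ) ≤ L := by exact_mod_cast hL
  have hθ0 : 2 * Real.pi / L ≤ 2 * Real.pi / L0 := div_le_div_of_nonneg_left (by positivity) hL0R hLR
  have h2RS' : 2 * (R + S) < L := by omega
  have hRL' : L / 2 + R < L := by omega
  obtain ⟨hmid_lo, hmid_hi⟩ := b1BracketR_cell L (2 * Real.pi / L0) R S s a n ha hn h2 hS hSR h2RS' hRL' hθ0
    ((n1 : ℝ) / νd) ν ((n2 : ℝ) / νd) hν1_0 hν1 hν2 hν2_lt
  have hTd' : (0 : ℝ) < Td := by exact_mod_cast hTd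
  have hTR : (2 * Real.pi / L0) ^ 2 * (Td : ℝ) ≤ Tn := by
    have h1 : (2 * Real.pi / L0) ^ 2 ≤ (2 * (((piHi : ℚ) : ℝ)) / L0) ^ 2 := by
      apply pow_le_pow_left₀ (by positivity)
      exact div_le_div_of_nonneg_right (by linarith) hL0R.le
    have h2' : (2 * (((piHi : ℚ) : ℝ)) / L0) ^ 2 * (Td : ℝ) ≤ Tn := by exact_mod_cast hT
    nlinarith
  have hDR : (0 : ℝ) < D := by exact_mod_cast hD
  have hn1lt : n1 < νd := by
    have hc1 : (n1 : ℚ) / νd * piHi ^ 2 < 4 := lt_of_le_of_lt (by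
      apply mul_le_mul_of_nonneg_right _ (by positivity)
      exact div_le_div_of_nonneg_right (by exact_mod_cast hn12) (by exact_mod_cast hνd.le)) hc
    have hP3 : (3 : ℚ) ≤ piHi := by unfold piHi; norm_num
    have hνdQ : (0 : ℚ) < νd := by exact_mod_cast hνd
    by_contra hcon
    push Not at hcon
    have : (1 : ℚ) ≤ (n1 : ℚ) / νd := by
      rw [le_div_iff₀ hνdQ, one_mul]; exact_mod_cast hcon
    nlinarith
  have elo := loSumZ_le n1 νd hνd hn1lt R S s a n D hn
  have ehi := fullSum_le_fullSumZ n2 νd Tn Td hTd hc (2 * Real.pi / L0) hTR hν2_lt R s a D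
  have etail := tailConst_le_tailConstQ n2 νd hνd (hn1.trans hn12) hc (R - S) n (by omega)
  have hloR : ((clo : ℚ) : ℝ) * D ≤ ((loSumZ n1 νd R S s a n D : ℤ) : ℝ) := by exact_mod_cast hlo
  have hhiR : ((fullSumZ n2 νd Tn Td R s a D : ℤ) : ℝ)
      ≤ (((chi : ℚ) : ℝ) - ((tailConstQ n2 νd (R - S) n : ℚ) : ℝ)) * D := by exact_mod_cast hhi
  constructor
  · have : ((clo : ℚ) : ℝ) ≤ loSum ((n1 : ℝ) / νd) R S s a := by
      rw [← mul_le_mul_iff_left₀ hDR]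
      calc ((clo : ℚ) : ℝ) * D ≤ _ := hloR
        _ ≤ (D : ℝ) * loSum ((n1 : ℝ) / νd) R S s a := elo
        _ = loSum ((n1 : ℝ) / νd) R S s a * D := mul_comm _ _
    exact this.trans hmid_lo
  · have : fullSum ((n2 : ℝ) / νd) (2 * Real.pi / L0) R s a
        ≤ ((chi : ℚ) : ℝ) - ((tailConstQ n2 νd (R - S) n : ℚ) : ℝ) := by
      rw [← mul_le_mul_iff_left₀ hDR]
      calc fullSum ((n2 : ℝ) / νd) (2 * Real.pi / L0) R s a * D
          = (D : ℝ) * fullSum ((n2 : ℝ) / νd) (2 * Real.pi / L0) R s a := mul_comm _ _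
        _ ≤ _ := ehi
        _ ≤ _ := hhiR
    linarith

end

end Summit.HubbardSuperconductivity.HubbardSuperconductivity.Theorems.AnisotropyChord.Transfer.Fibre3.B1
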